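import Literature.Geometry.Riemannian.SphericalCylinderEntropy
import Literature.Geometry.Riemannian.SphericalCylinderEntropySmallScales
import Mathlib.Analysis.Calculus.IteratedDeriv.Lemmas
import HarnessLib

/-!
# The Gegenbauer differential equation for the typed zonal polynomials of `S⁴`

Topic `Literature/Geometry/Riemannian`; continuation of `SphericalCylinderEntropy.lean` and
`SphericalCylinderEntropySmallScales.lean`.  The typed zonal heat kernel of `S⁴` of route
`SmoothPoincare4/CylinderEntropy` is the series `𝔥(τ, s) = ∑_k wt k τ · gegen k s` whose angular
factors are the EXPLICIT finite sums (DLMF 18.5.10 with `λ = 3/2`)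
`gegen k s = ∑_{l ≤ k/2} (-1)^l (3/2)_{k-l} / (l! (k-2l)!) · (2s)^{k-2l} = C_k^{(3/2)}(s)`.
Nothing about these sums beyond size bounds was in the tree.  This file proves the algebraic heart
of "the typed kernel is the heat kernel": the Gegenbauer differential equation

  `(1 - s²) · (gegen k)''(s) - 4 s · (gegen k)'(s) + k (k + 3) · gegen k s = 0`   (`gegen_ode`),

i.e. `s ↦ C_k^{(3/2)}(⟨z', p'⟩)` is an eigenfunction of the Laplacian of `S⁴` (which on zonal
functions of `s = cos θ` is `(1 - s²) ∂_s² - 4 s ∂_s`) with eigenvalue `-k(k+3)` — exactly the exponent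
of the typed heat weight `wt k τ = e^{-k(k+3)τ} (2k+3)/3`.  Proved here (everything; no facts, no
definitions):

* `hasDerivAt_gegen`, `deriv_gegen`, `hasDerivAt_deriv_gegen`, `deriv_deriv_gegen`,
  `iteratedDeriv_two_gegen`, `contDiff_gegen` — the explicit first and second derivatives of the
  finite sum (term-wise `((2s)^m)' = 2m (2s)^{m-1}`);
* `gegen_ode_term` — the monomial identity
  `(1 - s²) (a (2s)^m)'' - 4 s (a (2s)^m)' + m(m+3) a (2s)^m = 4 m (m-1) a (2s)^{m-2}`;
* `gegen_coeff_rec` — the two-term recurrence of the DLMF coefficients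
  `4 (k-2l)(k-2l-1) a_l + 2 (l+1)(2k-2l+1) a_{l+1} = 0`,
  `a_l = (-1)^l (3/2)_{k-l} / (l! (k-2l)!)` (from `(3/2)_{k-l} = (3/2)_{k-l-1} (k - l + 1/2)`);
* `gegen_ode_sum_eq_zero` — the resulting telescoping of the ODE applied to the finite sum, for any
  coefficient sequence obeying the recurrence;
* `gegen_ode`, `gegen_ode'` (with `iteratedDeriv 2`), `gegen_eigen` — **the Gegenbauer equation**
  (DLMF 18.8, row `C_n^{(λ)}`: `(1 - x²) y'' - (2λ+1) x y' + n(n+2λ) y = 0`, `λ = 3/2`);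
* `abs_gegenCoeff_le`, `abs_gegen_le_of_abs_le`, `abs_deriv_gegen_le_of_abs_le`,
  `abs_deriv_deriv_gegen_le_of_abs_le` — exponential bounds `(k+1)² (8R)^k`, `2k (k+1)² (8R)^k`,
  `4k² (k+1)² (8R)^k` for `C_k`, `C_k'`, `C_k''` on `|s| ≤ R` (`R ≥ 1`), the majorants for term-wise
  differentiation of the heat-kernel series (`SphericalCylinderEntropyHeatEquation.lean`).

## References
* NIST Digital Library of Mathematical Functions, §18.5.10 (explicit sum), §18.8 (Table 18.8.1,
  differential equations), §18.9 (recurrences).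
* R. S. Hamilton, *A matrix Harnack estimate for the heat equation*, Comm. Anal. Geom. 1 (1993),
  113–126; *Monotonicity formulas for parabolic flows on manifolds*, ibid. 127–137.
-/

noncomputable section

open scoped BigOperators Topology ContDiff
open Filter Set Finset

namespace Literature.Geometry.Riemannian.SphericalCylinderEntropy

/-! ### Derivatives of the typed Gegenbauer polynomials -/

/-- `((2x)^n)' = 2 n (2x)^{n-1}`. [folklore] -/
theorem hasDerivAt_two_mul_pow (n : ℕ) (s : ℝ) :
    HasDerivAt (fun x : ℝ => (2 * x) ^ n) (2 * (n : ℝ) * (2 * s) ^ (n - 1)) s := by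
  have h := ((hasDerivAt_id' s).const_mul (2 : ℝ)).fun_pow n
  exact h.congr_deriv (by ring)

/-- **First derivative of `C_k^{(3/2)}`** as the term-wise derivative of the explicit sum:
`C_k'(s) = ∑_l a_l · 2 (k-2l) (2s)^{k-2l-1}`. [folklore] -/
theorem hasDerivAt_gegen (k : ℕ) (s : ℝ) :
    HasDerivAt (gegen k) (∑ l ∈ Finset.range (k / 2 + 1), (-1 : ℝ) ^ l *
      (∏ j ∈ Finset.range (k - l), ((3 : ℝ) / 2 + (j : ℝ))) /
        (((l.factorial : ℕ) : ℝ) * (((k - 2 * l).factorial : ℕ) : ℝ)) *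
      (2 * ((k - 2 * l : ℕ) : ℝ) * (2 * s) ^ (k - 2 * l - 1))) s := by
  unfold gegen
  exact HasDerivAt.fun_sum fun l _ => (hasDerivAt_two_mul_pow (k - 2 * l) s).const_mul _

/-- The derivative of `C_k^{(3/2)}` as a function. [folklore] -/
theorem deriv_gegen (k : ℕ) :
    deriv (gegen k) = fun s => ∑ l ∈ Finset.range (k / 2 + 1), (-1 : ℝ) ^ l *
      (∏ j ∈ Finset.range (k - l), ((3 : ℝ) / 2 + (j : ℝ))) /
        (((l.factorial : ℕ) : ℝ) * (((k - 2 * l).factorial : ℕ) : ℝ)) *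
      (2 * ((k - 2 * l : ℕ) : ℝ) * (2 * s) ^ (k - 2 * l - 1)) :=
  funext fun s => (hasDerivAt_gegen k s).deriv

/-- **Second derivative of `C_k^{(3/2)}`**: `C_k''(s) = ∑_l a_l · 4 (k-2l)(k-2l-1) (2s)^{k-2l-2}`.
[folklore] -/
theorem hasDerivAt_deriv_gegen (k : ℕ) (s : ℝ) :
    HasDerivAt (deriv (gegen k)) (∑ l ∈ Finset.range (k / 2 + 1), (-1 : ℝ) ^ l *
      (∏ j ∈ Finset.range (k - l), ((3 : ℝ) / 2 + (j : ℝ))) /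
        (((l.factorial : ℕ) : ℝ) * (((k - 2 * l).factorial : ℕ) : ℝ)) *
      (4 * ((k - 2 * l : ℕ) : ℝ) * ((k - 2 * l - 1 : ℕ) : ℝ) * (2 * s) ^ (k - 2 * l - 2))) s := by
  rw [deriv_gegen]
  refine HasDerivAt.fun_sum fun l _ => ?_
  have h := ((hasDerivAt_two_mul_pow (k - 2 * l - 1) s).const_mul
    (2 * ((k - 2 * l : ℕ) : ℝ))).const_mul
    ((-1 : ℝ) ^ l * (∏ j ∈ Finset.range (k - l), ((3 : ℝ) / 2 + (j : ℝ))) /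
        (((l.factorial : ℕ) : ℝ) * (((k - 2 * l).factorial : ℕ) : ℝ)))
  have h2 : k - 2 * l - 1 - 1 = k - 2 * l - 2 := by omega
  rw [h2] at h
  exact (h.congr_deriv (by ring)).congr_of_eventuallyEq
    (Filter.Eventually.of_forall fun x => by ring)

/-- The second derivative of `C_k^{(3/2)}` as a function. [folklore] -/
theorem deriv_deriv_gegen (k : ℕ) :
    deriv (deriv (gegen k)) = fun s => ∑ l ∈ Finset.range (k / 2 + 1), (-1 : ℝ) ^ l *
      (∏ j ∈ Finset.range (k - l), ((3 : ℝ) / 2 + (j : ℝ))) /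
        (((l.factorial : ℕ) : ℝ) * (((k - 2 * l).factorial : ℕ) : ℝ)) *
      (4 * ((k - 2 * l : ℕ) : ℝ) * ((k - 2 * l - 1 : ℕ) : ℝ) * (2 * s) ^ (k - 2 * l - 2)) :=
  funext fun s => (hasDerivAt_deriv_gegen k s).deriv

/-- `iteratedDeriv 2 (gegen k) = (gegen k)''`. [folklore] -/
theorem iteratedDeriv_two_gegen (k : ℕ) : iteratedDeriv 2 (gegen k) = deriv (deriv (gegen k)) := by
  rw [iteratedDeriv_succ, iteratedDeriv_one]

/-- `C_k^{(3/2)}` is differentiable. [folklore] -/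
theorem differentiable_gegen (k : ℕ) : Differentiable ℝ (gegen k) := fun s =>
  (hasDerivAt_gegen k s).differentiableAt

/-- `(C_k^{(3/2)})'` is differentiable. [folklore] -/
theorem differentiable_deriv_gegen (k : ℕ) : Differentiable ℝ (deriv (gegen k)) := fun s =>
  (hasDerivAt_deriv_gegen k s).differentiableAt

/-- `C_k^{(3/2)}` is smooth (indeed analytic: a polynomial). [folklore] -/
theorem contDiff_gegen (k : ℕ) {n : WithTop ℕ∞} : ContDiff ℝ n (gegen k) := by
  have h : ContDiff ℝ ⊤ (gegen k) := by
    unfold gegen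
    fun_prop
  exact h.of_le le_top

/-! ### The Gegenbauer differential equation -/

/-- **The monomial identity behind the Gegenbauer equation**: for `y = a (2s)^m`,
`(1 - s²) y'' - 4 s y' + m (m+3) y = 4 m (m-1) a (2s)^{m-2}` (with `y' = 2 m a (2s)^{m-1}`,
`y'' = 4 m (m-1) a (2s)^{m-2}`; the cases `m = 0, 1` are degenerate but consistent with `ℕ`-subtraction).
[folklore] -/
theorem gegen_ode_term (a s : ℝ) (m : ℕ) :
    (1 - s ^ 2) * (a * (4 * (m : ℝ) * ((m - 1 : ℕ) : ℝ) * (2 * s) ^ (m - 2)))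
      - 4 * s * (a * (2 * (m : ℝ) * (2 * s) ^ (m - 1)))
      + (m : ℝ) * ((m : ℝ) + 3) * (a * (2 * s) ^ m)
      = a * (4 * (m : ℝ) * ((m - 1 : ℕ) : ℝ) * (2 * s) ^ (m - 2)) := by
  rcases m with _ | _ | m
  · simp
  · simp; ring
  · simp only [show m + 1 + 1 - 1 = m + 1 by omega, show m + 1 + 1 - 2 = m by omega]
    push_cast
    ring

/-- **The two-term recurrence of the DLMF coefficients** `a_l = (-1)^l (3/2)_{k-l} / (l! (k-2l)!)` of
`C_k^{(3/2)}`: for `2l + 2 ≤ k`, `4 (k-2l)(k-2l-1) a_l + 2 (l+1) (2k-2l+1) a_{l+1} = 0`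
(`(3/2)_{k-l} = (3/2)_{k-l-1} · (k - l + 1/2)`, `(k-2l)! = (k-2l)(k-2l-1)(k-2l-2)!`,
`(l+1)! = (l+1) l!`). [folklore] -/
theorem gegen_coeff_rec (k l : ℕ) (h : 2 * l + 2 ≤ k) :
    4 * ((k - 2 * l : ℕ) : ℝ) * ((k - 2 * l - 1 : ℕ) : ℝ) *
        ((-1 : ℝ) ^ l * (∏ j ∈ Finset.range (k - l), ((3 : ℝ) / 2 + (j : ℝ))) /
          (((l.factorial : ℕ) : ℝ) * (((k - 2 * l).factorial : ℕ) : ℝ)))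
      + 2 * ((l : ℝ) + 1) * (2 * (k : ℝ) - 2 * (l : ℝ) + 1) *
        ((-1 : ℝ) ^ (l + 1) * (∏ j ∈ Finset.range (k - (l + 1)), ((3 : ℝ) / 2 + (j : ℝ))) /
          ((((l + 1).factorial : ℕ) : ℝ) * (((k - 2 * (l + 1)).factorial : ℕ) : ℝ))) = 0 := by
  obtain ⟨n, rfl⟩ : ∃ n, k = 2 * l + 2 + n := ⟨k - (2 * l + 2), by omega⟩
  have e1 : 2 * l + 2 + n - 2 * l = n + 2 := by omega
  have e2 : n + 2 - 1 = n + 1 := by omega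
  have e3 : 2 * l + 2 + n - l = (l + 1 + n) + 1 := by omega
  have e4 : 2 * l + 2 + n - (l + 1) = l + 1 + n := by omega
  have e5 : 2 * l + 2 + n - 2 * (l + 1) = n := by omega
  rw [e1, e2, e3, e4, e5, Finset.prod_range_succ, Nat.factorial_succ (n + 1), Nat.factorial_succ n,
    Nat.factorial_succ l]
  push_cast
  field_simp
  ring

/-- **Telescoping of the Gegenbauer operator on the explicit sum**: for any coefficients `a_l` obeying
the two-term recurrence of `gegen_coeff_rec`, the operator `(1 - s²) ∂² - 4 s ∂ + k(k+3)` applied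
term-wise to `∑_{l ≤ k/2} a_l (2s)^{k-2l}` sums to zero: each term equals
`B_l + C_l` with `B_l = 4 (k-2l)(k-2l-1) a_l (2s)^{k-2l-2}`, `C_l = 2l (2k-2l+3) a_l (2s)^{k-2l}`
(`k(k+3) - m(m+3) = 2l(2k-2l+3)` for `m = k - 2l`), `C_0 = 0`, `B_{k/2} = 0`, and
`B_l + C_{l+1} = 0` by the recurrence. [folklore] -/
theorem gegen_ode_sum_eq_zero (k : ℕ) (a : ℕ → ℝ) (s : ℝ)
    (hrec : ∀ l, 2 * l + 2 ≤ k →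
      4 * ((k - 2 * l : ℕ) : ℝ) * ((k - 2 * l - 1 : ℕ) : ℝ) * a l
        + 2 * ((l : ℝ) + 1) * (2 * (k : ℝ) - 2 * (l : ℝ) + 1) * a (l + 1) = 0) :
    ∑ l ∈ Finset.range (k / 2 + 1),
      ((1 - s ^ 2) * (a l * (4 * ((k - 2 * l : ℕ) : ℝ) * ((k - 2 * l - 1 : ℕ) : ℝ) *
          (2 * s) ^ (k - 2 * l - 2)))
        - 4 * s * (a l * (2 * ((k - 2 * l : ℕ) : ℝ) * (2 * s) ^ (k - 2 * l - 1)))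
        + (k : ℝ) * ((k : ℝ) + 3) * (a l * (2 * s) ^ (k - 2 * l))) = 0 := by
  have hsplit : ∀ l ∈ Finset.range (k / 2 + 1),
      ((1 - s ^ 2) * (a l * (4 * ((k - 2 * l : ℕ) : ℝ) * ((k - 2 * l - 1 : ℕ) : ℝ) *
          (2 * s) ^ (k - 2 * l - 2)))
        - 4 * s * (a l * (2 * ((k - 2 * l : ℕ) : ℝ) * (2 * s) ^ (k - 2 * l - 1)))
        + (k : ℝ) * ((k : ℝ) + 3) * (a l * (2 * s) ^ (k - 2 * l)))
      = a l * (4 * ((k - 2 * l : ℕ) : ℝ) * ((k - 2 * l - 1 : ℕ) : ℝ) * (2 * s) ^ (k - 2 * l - 2))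
        + 2 * (l : ℝ) * (2 * (k : ℝ) - 2 * (l : ℝ) + 3) * (a l * (2 * s) ^ (k - 2 * l)) := by
    intro l hl
    have hl' : 2 * l ≤ k := by have := Finset.mem_range.1 hl; omega
    have hm : ((k - 2 * l : ℕ) : ℝ) = (k : ℝ) - 2 * (l : ℝ) := by
      rw [Nat.cast_sub hl']; push_cast; ring
    have key := gegen_ode_term (a l) s (k - 2 * l)
    have hk : (k : ℝ) * ((k : ℝ) + 3) = ((k - 2 * l : ℕ) : ℝ) * (((k - 2 * l : ℕ) : ℝ) + 3) +
        2 * (l : ℝ) * (2 * (k : ℝ) - 2 * (l : ℝ) + 3) := by rw [hm]; ring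
    linear_combination key + (a l * (2 * s) ^ (k - 2 * l)) * hk
  rw [Finset.sum_congr rfl hsplit, Finset.sum_add_distrib, Finset.sum_range_succ, Finset.sum_range_succ']
  have hBL : ((k - 2 * (k / 2) - 1 : ℕ) : ℝ) = 0 := by
    rw [show k - 2 * (k / 2) - 1 = 0 by omega, Nat.cast_zero]
  rw [hBL]
  simp only [mul_zero, zero_mul, Nat.cast_zero, add_zero]
  rw [← Finset.sum_add_distrib]
  refine Finset.sum_eq_zero fun l hl => ?_
  have hl' : 2 * l + 2 ≤ k := by have := Finset.mem_range.1 hl; omega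
  have e1 : k - 2 * (l + 1) = k - 2 * l - 2 := by omega
  rw [e1]
  have := hrec l hl'
  push_cast
  linear_combination ((2 * s) ^ (k - 2 * l - 2)) * this

/-- **The Gegenbauer differential equation for the typed zonal polynomials of `S⁴`**:
`(1 - s²) C_k'' (s) - 4 s C_k'(s) + k (k+3) C_k(s) = 0` for `C_k = gegen k = C_k^{(3/2)}` and every
real `s` (DLMF Table 18.8.1, `λ = 3/2`: `(1-x²) y'' - (2λ+1) x y' + n (n + 2λ) y = 0`).  Equivalently
`z' ↦ C_k^{(3/2)}(⟨z', p'⟩)` is an eigenfunction of `Δ_{S⁴}` with eigenvalue `-k(k+3)`, the exponent of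
the typed heat weight `wt k`. [cite: DLMF, 18.8 Table 18.8.1 and 18.5.10] -/
theorem gegen_ode (k : ℕ) (s : ℝ) :
    (1 - s ^ 2) * deriv (deriv (gegen k)) s - 4 * s * deriv (gegen k) s
      + (k : ℝ) * ((k : ℝ) + 3) * gegen k s = 0 := by
  rw [deriv_deriv_gegen, deriv_gegen]
  simp only [gegen]
  rw [Finset.mul_sum, Finset.mul_sum, Finset.mul_sum, ← Finset.sum_sub_distrib,
    ← Finset.sum_add_distrib]
  exact gegen_ode_sum_eq_zero k _ s (fun l hl => gegen_coeff_rec k l hl)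

/-- The Gegenbauer equation with `iteratedDeriv`. [folklore] -/
theorem gegen_ode' (k : ℕ) (s : ℝ) :
    (1 - s ^ 2) * iteratedDeriv 2 (gegen k) s - 4 * s * iteratedDeriv 1 (gegen k) s
      + (k : ℝ) * ((k : ℝ) + 3) * gegen k s = 0 := by
  rw [iteratedDeriv_two_gegen, iteratedDeriv_one]
  exact gegen_ode k s

/-- **Eigenfunction form**: `(1 - s²) C_k'' - 4 s C_k' = -k(k+3) C_k` — the zonal Laplacian of `S⁴`
applied to `C_k^{(3/2)}`. [folklore] -/
theorem gegen_eigen (k : ℕ) (s : ℝ) :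
    (1 - s ^ 2) * deriv (deriv (gegen k)) s - 4 * s * deriv (gegen k) s
      = -((k : ℝ) * ((k : ℝ) + 3)) * gegen k s := by
  linear_combination gegen_ode k s

/-! ### Exponential bounds for `C_k`, `C_k'`, `C_k''` on `|s| ≤ R` -/

/-- The DLMF coefficients are bounded by `(k+1) 4^k` (the case `s = 1/2` of `abs_gegenTerm_le`).
[folklore] -/
theorem abs_gegenCoeff_le (k l : ℕ) (hl : 2 * l ≤ k) :
    |(-1 : ℝ) ^ l * (∏ j ∈ Finset.range (k - l), ((3 : ℝ) / 2 + (j : ℝ))) /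
        (((l.factorial : ℕ) : ℝ) * (((k - 2 * l).factorial : ℕ) : ℝ))| ≤ ((k : ℝ) + 1) * 4 ^ k := by
  have h := abs_gegenTerm_le k l hl (s := 1 / 2) (by norm_num)
  have h1 : (2 * (1 / 2 : ℝ)) ^ (k - 2 * l) = 1 := by norm_num
  rwa [h1, mul_one] at h

/-- `|2s|^e ≤ (2R)^k` for `|s| ≤ R`, `R ≥ 1`, `e ≤ k`. [folklore] -/
theorem abs_two_mul_pow_le {R s : ℝ} (hR : 1 ≤ R) (hs : |s| ≤ R) {e k : ℕ} (he : e ≤ k) :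
    |2 * s| ^ e ≤ (2 * R) ^ k := by
  have h2s : |2 * s| ≤ 2 * R := by rw [abs_mul, abs_two]; linarith
  calc |2 * s| ^ e ≤ (2 * R) ^ e := pow_le_pow_left₀ (abs_nonneg _) h2s _
    _ ≤ (2 * R) ^ k := pow_le_pow_right₀ (by linarith) he

/-- **Abstract bound for the coefficient sums**: if `|w_l| ≤ W` on the range and the exponents are
`≤ k`, then `|∑_{l ≤ k/2} a_l (w_l (2s)^{e_l})| ≤ (k+1)² 4^k W (2R)^k` for `|s| ≤ R`, `R ≥ 1`.
[folklore] -/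
theorem abs_sum_gegenCoeff_mul_le (k : ℕ) {R s : ℝ} (hR : 1 ≤ R) (hs : |s| ≤ R) (w : ℕ → ℝ)
    (e : ℕ → ℕ) {W : ℝ} (hW : 0 ≤ W) (hw : ∀ l ∈ Finset.range (k / 2 + 1), |w l| ≤ W)
    (he : ∀ l ∈ Finset.range (k / 2 + 1), e l ≤ k) :
    |∑ l ∈ Finset.range (k / 2 + 1), (-1 : ℝ) ^ l *
      (∏ j ∈ Finset.range (k - l), ((3 : ℝ) / 2 + (j : ℝ))) /
        (((l.factorial : ℕ) : ℝ) * (((k - 2 * l).factorial : ℕ) : ℝ)) * (w l * (2 * s) ^ (e l))|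
      ≤ ((k : ℝ) + 1) ^ 2 * 4 ^ k * W * (2 * R) ^ k := by
  refine (Finset.abs_sum_le_sum_abs _ _).trans ?_
  have hterm : ∀ l ∈ Finset.range (k / 2 + 1),
      |(-1 : ℝ) ^ l * (∏ j ∈ Finset.range (k - l), ((3 : ℝ) / 2 + (j : ℝ))) /
        (((l.factorial : ℕ) : ℝ) * (((k - 2 * l).factorial : ℕ) : ℝ)) * (w l * (2 * s) ^ (e l))|
        ≤ ((k : ℝ) + 1) * 4 ^ k * (W * (2 * R) ^ k) := by
    intro l hl
    have hl' : 2 * l ≤ k := by have := Finset.mem_range.1 hl; omega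
    rw [abs_mul, abs_mul, abs_pow]
    refine mul_le_mul (abs_gegenCoeff_le k l hl') ?_ (by positivity) (by positivity)
    exact mul_le_mul (hw l hl) (abs_two_mul_pow_le hR hs (he l hl)) (by positivity) hW
  refine (Finset.sum_le_sum hterm).trans ?_
  rw [Finset.sum_const, Finset.card_range, nsmul_eq_mul]
  have hk : ((k / 2 + 1 : ℕ) : ℝ) ≤ (k : ℝ) + 1 := by
    have : k / 2 + 1 ≤ k + 1 := by omega
    exact_mod_cast this
  have h0 : 0 ≤ ((k : ℝ) + 1) * 4 ^ k * (W * (2 * R) ^ k) := by positivity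
  calc ((k / 2 + 1 : ℕ) : ℝ) * (((k : ℝ) + 1) * 4 ^ k * (W * (2 * R) ^ k))
      ≤ ((k : ℝ) + 1) * (((k : ℝ) + 1) * 4 ^ k * (W * (2 * R) ^ k)) :=
        mul_le_mul_of_nonneg_right hk h0
    _ = _ := by ring

/-- **`|C_k^{(3/2)}(s)| ≤ (k+1)² (8R)^k` for `|s| ≤ R`, `R ≥ 1`** (extends
`abs_gegen_le_sq_mul_four_pow`, the case `R = 1`, up to the harmless factor `2^k`). [folklore] -/
theorem abs_gegen_le_of_abs_le (k : ℕ) {R s : ℝ} (hR : 1 ≤ R) (hs : |s| ≤ R) :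
    |gegen k s| ≤ ((k : ℝ) + 1) ^ 2 * (8 * R) ^ k := by
  have h := abs_sum_gegenCoeff_mul_le k hR hs (fun _ => 1) (fun l => k - 2 * l) zero_le_one
    (fun l _ => by simp) (fun l _ => by omega)
  simp only [one_mul] at h
  have h8 : (8 * R) ^ k = 4 ^ k * (2 * R) ^ k := by rw [← mul_pow]; ring
  rw [h8]
  calc |gegen k s| = _ := by rfl
    _ ≤ ((k : ℝ) + 1) ^ 2 * 4 ^ k * 1 * (2 * R) ^ k := h
    _ = _ := by ring

/-- **`|C_k'(s)| ≤ 2k (k+1)² (8R)^k` for `|s| ≤ R`, `R ≥ 1`.** [folklore] -/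
theorem abs_deriv_gegen_le_of_abs_le (k : ℕ) {R s : ℝ} (hR : 1 ≤ R) (hs : |s| ≤ R) :
    |deriv (gegen k) s| ≤ 2 * (k : ℝ) * ((k : ℝ) + 1) ^ 2 * (8 * R) ^ k := by
  have h := abs_sum_gegenCoeff_mul_le k hR hs (fun l => 2 * ((k - 2 * l : ℕ) : ℝ))
    (fun l => k - 2 * l - 1) (W := 2 * (k : ℝ)) (by positivity)
    (fun l _ => by
      rw [abs_of_nonneg (by positivity)]
      have : ((k - 2 * l : ℕ) : ℝ) ≤ (k : ℝ) := by exact_mod_cast Nat.sub_le k (2 * l)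
      linarith)
    (fun l _ => by omega)
  have h8 : (8 * R) ^ k = 4 ^ k * (2 * R) ^ k := by rw [← mul_pow]; ring
  rw [deriv_gegen, h8]
  calc _ ≤ ((k : ℝ) + 1) ^ 2 * 4 ^ k * (2 * (k : ℝ)) * (2 * R) ^ k := h
    _ = _ := by ring

/-- **`|C_k''(s)| ≤ 4k² (k+1)² (8R)^k` for `|s| ≤ R`, `R ≥ 1`.** [folklore] -/
theorem abs_deriv_deriv_gegen_le_of_abs_le (k : ℕ) {R s : ℝ} (hR : 1 ≤ R) (hs : |s| ≤ R) :
    |deriv (deriv (gegen k)) s| ≤ 4 * (k : ℝ) ^ 2 * ((k : ℝ) + 1) ^ 2 * (8 * R) ^ k := by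
  have h := abs_sum_gegenCoeff_mul_le k hR hs
    (fun l => 4 * ((k - 2 * l : ℕ) : ℝ) * ((k - 2 * l - 1 : ℕ) : ℝ))
    (fun l => k - 2 * l - 2) (W := 4 * (k : ℝ) ^ 2) (by positivity)
    (fun l _ => by
      rw [abs_of_nonneg (by positivity)]
      have h1 : ((k - 2 * l : ℕ) : ℝ) ≤ (k : ℝ) := by exact_mod_cast Nat.sub_le k (2 * l)
      have h2 : ((k - 2 * l - 1 : ℕ) : ℝ) ≤ (k : ℝ) := by
        exact_mod_cast (Nat.sub_le _ 1).trans (Nat.sub_le k (2 * l))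
      have h3 : (0 : ℝ) ≤ ((k - 2 * l : ℕ) : ℝ) := by positivity
      have h4 : (0 : ℝ) ≤ ((k - 2 * l - 1 : ℕ) : ℝ) := by positivity
      nlinarith [mul_le_mul h1 h2 h4 (Nat.cast_nonneg k)])
    (fun l _ => by omega)
  have h8 : (8 * R) ^ k = 4 ^ k * (2 * R) ^ k := by rw [← mul_pow]; ring
  rw [deriv_deriv_gegen, h8]
  calc _ ≤ ((k : ℝ) + 1) ^ 2 * 4 ^ k * (4 * (k : ℝ) ^ 2) * (2 * R) ^ k := h
    _ = _ := by ring

end Literature.Geometry.Riemannian.SphericalCylinderEntropy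

end
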